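import Literature.NumberTheory.EllipticCurves.PastenValuationProductMestreOesterleProofs
import Literature.NumberTheory.EllipticCurves.Wiles2000CongruentProofs
import HarnessLib

/-!
# `1` is not a congruent number (Fermat), and the quartics `v⁴ ± 4u⁴ = ±a²`

Topic `NumberTheory/EllipticCurves`; namespace `Literature.NumberTheory.EllipticCurves`.

The tree already proves (in `Literature.NumberTheory.EllipticCurves.PastenValuationProductMestreOesterleProofs`,
namespace `MestreOesterle`) the two "table facts" of part 9) of the proof of Mestre–Oesterlé's
Théorème 1 — every rational point of `32A : y² = x³ − x` and of `64A : y² = x³ + x` has `y = 0`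
(`MestreOesterle.eq_zero_of_sq_eq_cube_sub_self`, `MestreOesterle.eq_zero_of_sq_eq_cube_add_self`,
by Fermat's descents) — and part 9) itself in the printed form
(`MestreOesterle.sq_mul_abs_ne_pow_eight`: for coprime `a, b`, `b > 0`, `a² ≠ 4b`,
`b²|a² − 4b|` is not an `8`-th power). This file records the classical consequences for the
congruent number curve `E_1 = congruentNumberCurve 1 = 32A` that the tree's BSD/Tunnell thread
states everything in terms of, and a coprimality-free Diophantine variant of part 9):

* `not_isCongruentNumber_one` — **Fermat**: `1` is not a congruent number (no right triangle with
  rational sides has area `1`) [Knapp, *Elliptic Curves*, Cor. 4.22 (Fermat)], with the rank-zero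
  and finiteness forms `mordellWeilRank_congruentNumberCurve_one` ("`E : y² = x³ − x` … has rank
  `0`", Knapp, proof of Cor. 4.22), `finite_point_congruentNumberCurve_one`, obtained through the
  tree's `Wiles2000.exists_nonsingular_ne_zero_of_isCongruentNumber`,
  `Wiles2000.mordellWeilRank_ne_zero_iff_isCongruentNumber` and
  `Wiles2000.infinite_point_iff_isCongruentNumber_holds`;
* `two_nsmul_point_congruentNumberCurve_one` — every `P ∈ E_1(ℚ)` satisfies `2 • P = 0`
  (Hardy–Wright Thm 473 phrases the twin statement for `y² = x³ + x` the same way: "`E(ℚ)` … is a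
  cyclic group of order `2`");
* `MestreOesterle.sq_sub_four_mul_fourth_pow_ne` — the Diophantine kernel of part 9) with its
  inputs taken as hypotheses and WITHOUT the coprimality of the printed statement: for `ε = ±1` and
  integers `a, u, v` with `uv ≠ 0`, `a² − 4u⁴ ≠ εv⁴` (Mestre–Oesterlé's point
  `(εv²/(a − 2u²), 2uv/(a − 2u²))` of `y² = x³ − εx` would have `y ≠ 0`). Delta w.r.t. the tree's
  `MestreOesterle.sq_mul_abs_ne_pow_eight`: there the hypotheses are `IsCoprime a b`, `0 < b`,
  `a² ≠ 4b` and the conclusion is about `b²|a² − 4b|`; here `b = u⁴` and `a² − 4b = εv⁴` are the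
  hypotheses (the paper's "Il existe donc `ε ∈ {−1, 1}` et des entiers `u` et `v` tels que `b = u⁴`
  et `a² − 4b = εv⁴`") and no coprimality is needed;
* `fourth_pow_add_four_mul_fourth_pow_ne_sq`, `four_mul_fourth_pow_sub_fourth_pow_ne_sq` — the
  two signs spelled out: `v⁴ + 4u⁴ ≠ a²` and `4u⁴ − v⁴ ≠ a²` for `uv ≠ 0`.

Fermat's `a⁴ − b⁴ ≠ c²` itself is `Literature.NumberTheory.EllipticCurves.fermat_fourth_pow_sub_fourth_pow_ne_sq`
(`FermatQuarticDescent`); Mathlib has `not_fermat_42` (`a⁴ + b⁴ ≠ c²`).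

## References

* [Knapp1993] A. W. Knapp, *Elliptic Curves*, Princeton 1992 — Cor. 4.22 (Fermat: `n = 1` is not
  congruent; proof: `y² = x³ − x` has rank `0`), Prop. 4.21, Lemma 4.20.
* [HardyWright2008] G. H. Hardy, E. M. Wright, *An Introduction to the Theory of Numbers*, 6th ed.
  — Thm 473 (`E : y² = x³ + x` has `E(ℚ) = {(0,0), O}`).
* [MestreOesterle1989] J.-F. Mestre, J. Oesterlé, J. reine angew. Math. 400 (1989) 173–184 —
  proof of Thm 1, part 9 (pp. 180–181).
-/

open WeierstrassCurve

namespace Literature.NumberTheory.EllipticCurves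

/-! ### Fermat: `1` is not a congruent number -/

/-- **Fermat: `1` is not a congruent number** — there is no right triangle with rational sides and
area `1` (Knapp, *Elliptic Curves*, Cor. 4.22 (Fermat); equivalently, the area of a Pythagorean
triangle is never a square). Proof: a congruent number `n` gives a rational point of
`E_n : y² = x³ − n²x` with `y ≠ 0` (the tree's
`Wiles2000.exists_nonsingular_ne_zero_of_isCongruentNumber`, Koblitz's point), impossible for
`n = 1` by the tree's `MestreOesterle.eq_zero_of_sq_eq_cube_sub_self` (every rational point of
`y² = x³ − x` has `y = 0`). [cite: Knapp1993, Cor. 4.22] -/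
theorem not_isCongruentNumber_one : ¬ IsCongruentNumber 1 := by
  intro h
  obtain ⟨x, y, hxy, hy⟩ := Wiles2000.exists_nonsingular_ne_zero_of_isCongruentNumber h
  have heq := (congruentNumberCurve_equation_iff (n := 1)).mp hxy.1
  simp only [Nat.cast_one, one_pow, one_mul] at heq
  exact hy (MestreOesterle.eq_zero_of_sq_eq_cube_sub_self heq)

/-- **`E_1 : y² = x³ − x` has Mordell–Weil rank `0`** (Knapp, Cor. 4.22, proof: "By Proposition
4.19, `E(ℚ)` has rank `0`"; with Prop. 4.21, "a square-free integer `n` fails to be congruent if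
and only if … `E(ℚ)` has rank `0`"). From `not_isCongruentNumber_one` and the tree's
`Wiles2000.mordellWeilRank_ne_zero_iff_isCongruentNumber`. [cite: Knapp1993, Cor. 4.22] -/
theorem mordellWeilRank_congruentNumberCurve_one : (congruentNumberCurve 1).mordellWeilRank = 0 := by
  by_contra h
  exact not_isCongruentNumber_one
    ((Wiles2000.mordellWeilRank_ne_zero_iff_isCongruentNumber one_pos).mp h)

/-- **`E_1(ℚ)` is finite** (`E_1 : y² = x³ − x`; Knapp, Cor. 4.22 with Lemma 4.20: the group is
`ℤ/2 ⊕ ℤ/2`). From `not_isCongruentNumber_one` and the tree's discharge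
`Wiles2000.infinite_point_iff_isCongruentNumber_holds` of Wiles's "`C_n(ℚ)` infinite `⟺ n`
congruent". [cite: Knapp1993, Cor. 4.22] -/
theorem finite_point_congruentNumberCurve_one : Finite (congruentNumberCurve 1).toAffine.Point := by
  rw [← not_infinite_iff_finite]
  intro h
  exact not_isCongruentNumber_one
    ((Wiles2000.infinite_point_iff_isCongruentNumber_holds one_pos).mp h)

/-- **Every rational point of `E_1 = 32A` is `2`-torsion** (Knapp, Lemma 4.20 / Cor. 4.22;
Mestre–Oesterlé p. 181: "les seuls points rationnels de ces courbes sont des points d'ordre 2"):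
for `P ∈ E_1(ℚ)`, `2 • P = 0`. An affine point has `y = 0`
(`MestreOesterle.eq_zero_of_sq_eq_cube_sub_self`) and is then its own negative (`a₁ = a₃ = 0`).
[cite: Knapp1993, Cor. 4.22] -/
theorem two_nsmul_point_congruentNumberCurve_one (P : (congruentNumberCurve 1).toAffine.Point) :
    2 • P = 0 := by
  rcases P with _ | ⟨x, y, hP⟩
  · show (2 : ℕ) • (0 : (congruentNumberCurve 1).toAffine.Point) = 0
    rw [two_nsmul, add_zero]
  · have heq := (congruentNumberCurve_equation_iff (n := 1)).mp hP.1
    simp only [Nat.cast_one, one_pow, one_mul] at heq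
    have hy : y = 0 := MestreOesterle.eq_zero_of_sq_eq_cube_sub_self heq
    subst hy
    rw [two_nsmul]
    exact Affine.Point.add_self_of_Y_eq (by simp [Affine.negY])

/-! ### Mestre–Oesterlé 1989, proof of Théorème 1, part 9: the coprimality-free Diophantine kernel -/

namespace MestreOesterle

/-- **Mestre–Oesterlé, proof of Thm 1, part 9 (`m = 8`), Diophantine kernel, inputs as
hypotheses** (pp. 180–181): "Il existe donc `ε ∈ {−1, 1}` et des entiers `u` et `v` tels que
`b = u⁴` et `a² − 4b = εv⁴`. Posons `x = ε v²/(a − 2u²)` et `y = 2uv/(a − 2u²)`, ce qui est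
licite puisque la non nullité de `Δ` implique celle de `a − 2u²`. Les nombres rationnels `x` et
`y` sont reliés par l'équation `y² = x³ − εx`. … Dans les deux cas, les seuls points rationnels de
ces courbes sont des points d'ordre 2. On a donc `y = 0`, d'où `uv = 0`, ce qui est absurde puisque
`Δ` est non nul." Formally: for `ε = ±1` and integers `a, u, v` with `u ≠ 0`, `v ≠ 0` one has
`a² − 4u⁴ ≠ εv⁴`. Part 9) as printed (coprime `a, b`, `b > 0`, `a² ≠ 4b` ⟹ `b²|a² − 4b|` is not
an `8`-th power) is the tree's `MestreOesterle.sq_mul_abs_ne_pow_eight`; the present variant takes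
`b = u⁴`, `a² − 4b = εv⁴` as hypotheses and needs NO coprimality of `a` and `b`. The table facts
are the tree's `MestreOesterle.eq_zero_of_sq_eq_cube_sub_self` (`32A`) and
`MestreOesterle.eq_zero_of_sq_eq_cube_add_self` (`64A`).
[cite: MestreOesterle1989, §4, proof of Thm 1, part 9] -/
theorem sq_sub_four_mul_fourth_pow_ne {a u v ε : ℤ} (hε : ε = 1 ∨ ε = -1)
    (hu : u ≠ 0) (hv : v ≠ 0) : a ^ 2 - 4 * u ^ 4 ≠ ε * v ^ 4 := by
  intro h
  -- `a − 2u² ≠ 0`, since `a² − 4u⁴ = (a − 2u²)(a + 2u²) = εv⁴ ≠ 0`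
  have hD : (a : ℚ) - 2 * (u : ℚ) ^ 2 ≠ 0 := by
    intro hD
    have hD' : a - 2 * u ^ 2 = 0 := by exact_mod_cast hD
    have h0 : ε * v ^ 4 = 0 := by
      rw [← h]
      linear_combination (a + 2 * u ^ 2) * hD'
    rcases mul_eq_zero.mp h0 with h0 | h0
    · rcases hε with rfl | rfl <;> norm_num at h0
    · exact hv (pow_eq_zero_iff (by norm_num) |>.mp h0)
  -- `w = 1/(a − 2u²)`, `x = ε v² w`, `y = 2uv w`
  set w : ℚ := ((a : ℚ) - 2 * (u : ℚ) ^ 2)⁻¹ with hw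
  have hinv : ((a : ℚ) - 2 * (u : ℚ) ^ 2) * w = 1 := mul_inv_cancel₀ hD
  have hw0 : w ≠ 0 := inv_ne_zero hD
  have hQ : (a : ℚ) ^ 2 - 4 * (u : ℚ) ^ 4 = (ε : ℚ) * (v : ℚ) ^ 4 := by exact_mod_cast h
  -- the point `(x, y)` lies on `y² = x³ − εx`
  have hcurve : (2 * u * v * w : ℚ) ^ 2 =
      ((ε : ℚ) * v ^ 2 * w) ^ 3 - (ε : ℚ) * ((ε : ℚ) * v ^ 2 * w) := by
    have hε2 : (ε : ℚ) ^ 2 = 1 := by rcases hε with rfl | rfl <;> norm_num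
    linear_combination (w ^ 3 * (v : ℚ) ^ 2) * hQ +
      (w ^ 3 * ((v : ℚ) ^ 2 * ((a : ℚ) - 2 * (u : ℚ) ^ 2) ^ 2 - (ε : ℚ) * (v : ℚ) ^ 6)) * hε2 -
      (4 * (u : ℚ) ^ 2 * (v : ℚ) ^ 2 * w ^ 2 +
        (ε : ℚ) ^ 2 * (v : ℚ) ^ 2 * w * (1 + w * ((a : ℚ) - 2 * (u : ℚ) ^ 2))) * hinv
  -- hence `y = 0` by the rational points of `32A` (`ε = 1`) / `64A` (`ε = −1`)
  have hy : (2 * u * v * w : ℚ) = 0 := by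
    rcases hε with rfl | rfl
    · push_cast at hcurve
      exact eq_zero_of_sq_eq_cube_sub_self (x := (v : ℚ) ^ 2 * w) (by linear_combination hcurve)
    · push_cast at hcurve
      exact eq_zero_of_sq_eq_cube_add_self (x := -((v : ℚ) ^ 2 * w))
        (by linear_combination hcurve)
  -- so `uv = 0`, contradicting `u, v ≠ 0`
  have huQ : (u : ℚ) ≠ 0 := by exact_mod_cast hu
  have hvQ : (v : ℚ) ≠ 0 := by exact_mod_cast hv
  exact mul_ne_zero (mul_ne_zero (mul_ne_zero two_ne_zero huQ) hvQ) hw0 hy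

end MestreOesterle

/-- **`v⁴ + 4u⁴ = a²` has no solution with `uv ≠ 0`** (the case `ε = 1` of
`MestreOesterle.sq_sub_four_mul_fourth_pow_ne`; classically the curve `X⁴ + 4Y⁴ = Z²`,
`2`-isogenous to Fermat's `X⁴ − Y⁴ = Z²`, governed by `32A : y² = x³ − x`).
[cite: MestreOesterle1989, §4, proof of Thm 1, part 9] -/
theorem fourth_pow_add_four_mul_fourth_pow_ne_sq {a u v : ℤ} (hu : u ≠ 0) (hv : v ≠ 0) :
    v ^ 4 + 4 * u ^ 4 ≠ a ^ 2 := by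
  intro h
  exact MestreOesterle.sq_sub_four_mul_fourth_pow_ne (a := a) (ε := 1) (Or.inl rfl) hu hv
    (by linear_combination (-1 : ℤ) * h)

/-- **`4u⁴ − v⁴ = a²` has no solution with `uv ≠ 0`** (the case `ε = −1` of
`MestreOesterle.sq_sub_four_mul_fourth_pow_ne`; classically `X⁴ − 4Y⁴ = −Z²`, governed by the
curve `64A : y² = x³ + x`). [cite: MestreOesterle1989, §4, proof of Thm 1, part 9] -/
theorem four_mul_fourth_pow_sub_fourth_pow_ne_sq {a u v : ℤ} (hu : u ≠ 0) (hv : v ≠ 0) :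
    4 * u ^ 4 - v ^ 4 ≠ a ^ 2 := by
  intro h
  exact MestreOesterle.sq_sub_four_mul_fourth_pow_ne (a := a) (ε := -1) (Or.inr rfl) hu hv
    (by linear_combination (-1 : ℤ) * h)

end Literature.NumberTheory.EllipticCurves
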